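import Summits.ResolutionOfSingularities.ResolutionOfSingularities.Theorems.FrobeniusClosingPatchingRelPerfectDepthFlagCascadeDescent
import Summits.ResolutionOfSingularities.ResolutionOfSingularities.Theorems.FrobeniusClosingPatchingRelPerfectDepthFlagLegalTargets
import Summits.ResolutionOfSingularities.ResolutionOfSingularities.Theorems.FrobeniusClosingPatchingRelPerfectDepthFlagSeqState
import Literature.AlgebraicGeometry.Hironaka2017.PermissibleLSB
import HarnessLib

/-!
# Crux `PatchingRelPerfect` (stmt-ResolutionOfSingularities-16161), chain W5.2 — T6-E1b residual: **`Cascade₂` HOLDS modulo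
# [CoP1] Prop. 4.4** — `DepthTargets.cascade₂_of_prop44 : CossartPiltant2008_prop44 → Cascade₂`

[OURS · L1 W5.2] NOT statements of the manuscript under review (Hironaka 2017); AI-written, weaker than expert review.  F-33
`CossartPiltant2008_prop44` is the explicit CONDITIONAL hypothesis of the closer (NOT an admissible premise of the chain).
The target `DepthTargets.Cascade₂` / `CascadeEnd₂` is res-L1-w52-idea-1's (TARGETS module p529765, filer res-type-003).

ROUTE (idea-1's Sketch v9 (9b), assembled by res-D-pv-054): for `𝒥 = 𝔟 ⊔ R₁²` on the regular excellent integral threefold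
`E`: the CHILD cascade at `N = 2` (`DepthCascade.exists_childCascade`, `prop44From_of_prop44`) is a Σ-permissible sequence for
`(𝒥, 2)` ending at `D · J` (`IsChildCascade.isSingPermissibleSeq`, PROVED here: child centres lie in `{ord J = μ}`, `μ ≥ N`,
hence in `{ord (D·J) ≥ N}`, and `τᶜ(D·J, N) = (D𝒪·𝓘_exc^{μ-N})·τᶜ(J, μ)` by effective-Cartier cancellation); then ONE
companion phase `μ = 1` (`companionCascade_of_descent` with `companionDescent_of_prop44`; `INV(1)` at its start is «ord J < 2»);
composition (`IsSingPermissibleSeq.comp`); idea-1's FORMAT TRANSPORT (9a) `IsSingPermissibleSeq.exists_isFlagSeq` (re-homed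
here VERBATIM from Sketch v9 with its helper `sup_sq_sup_eq`) reads the Σ-permissible sequence as a `DepthTargets.IsFlagSeq`
with `𝒥' = 𝔟' ⊔ R₁'²`; `FlagState₃` by the tree's `IsFlagSeq.flagState₃`; and `CascadeEnd₂` is `INV(0)`: `𝒥' = D'·J'`, `D'`
effective Cartier (stage data), `ord J' ≤ 1`, `ord_x J' ≥ 1 ⇒ ord_x D' = 0`.

## References
* V. Cossart, O. Piltant, J. Algebra 320 (2008), Prop. 4.4. [CossartPiltant2008]
* E. Bierstone, D. Grigoriev, P. Milman, J. Włodarczyk (2011), Def. 3.1.3, §3.2, Lemma 3.7.1. [BierstoneGrigorievMilmanWlodarczyk2011]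
* J. Kollár, *Lectures on Resolution of Singularities* (2007), 3.30.2, 3.111 Step 3. [Kollar2007]
-/

-- `Summit.<Summit>.<Sub>.Theorems` with `Sub = Summit` (single-conjunct summit, D-0017)
set_option linter.dupNamespace false

noncomputable section

open CategoryTheory CategoryTheory.Limits AlgebraicGeometry TopologicalSpace IsLocalRing
open Literature.AlgebraicGeometry.Resolution

namespace Summit.ResolutionOfSingularities.ResolutionOfSingularities.Theorems

universe u

namespace DepthCascade

open Scheme.IdealSheafData DepthTargets

variable {X : Scheme.{u}}

/-! ## (9a) FORMAT TRANSPORT (res-L1-w52-idea-1, Sketch v9 §9, verbatim) -/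

/-- The idempotent-semiring identity behind the flag law: `A ⊔ (A ⊔ B)² = A ⊔ B²`. PROVED. [folklore] -/
theorem sup_sq_sup_eq {Y : Scheme.{u}} (A B : Y.IdealSheafData) : A ⊔ (A ⊔ B) ^ 2 = A ⊔ B ^ 2 := by
  have hA1 : ∀ C : Y.IdealSheafData, A * C ≤ A := fun C => by
    have h : A * C ≤ A * 1 :=
      mul_le_mul_of_nonneg_left (by rw [Scheme.IdealSheafData.one_eq_top]; exact le_top) (by simp)
    simpa using h
  have hA2 : ∀ C : Y.IdealSheafData, C * A ≤ A := fun C => by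
    rw [mul_comm]; exact hA1 C
  apply le_antisymm
  · refine sup_le le_sup_left ?_
    rw [sq, Scheme.IdealSheafData.mul_inf, Scheme.IdealSheafData.inf_mul,
      Scheme.IdealSheafData.inf_mul, sq]
    exact sup_le (sup_le ((hA1 A).trans le_sup_left) ((hA2 B).trans le_sup_left))
      (sup_le ((hA1 B).trans le_sup_left) le_sup_right)
  · exact sup_le le_sup_left
      ((pow_le_pow_left₀ (by simp) (le_sup_right : B ≤ A ⊔ B) 2).trans le_sup_right)


/-- [OURS · L1 W5.2] **(9a) FORMAT TRANSPORT.**  On a regular locally Noetherian scheme, a Σ-permissible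
sequence for the flag marked ideal `(𝔟 ⊔ R₁², 2)` (centres regular integral inside `{ord ≥ 2}`, §4) is a
flag sequence in the sense of plan-1's `DepthTargets.IsFlagSeq` (centres with `𝔟' ≤ C²`, `R₁' ≤ C`, flag
laws `𝔟'' = τᶜ(𝔟',2)`, `R₁'' = τᶜ(𝔟',2) ⊔ τᶜ(R₁',1)`), and the weight-two transform of `𝔟 ⊔ R₁²` is
again `𝔟' ⊔ R₁'²`; regularity and local Noetherianity propagate.  PROVED. [folklore] -/
theorem IsSingPermissibleSeq.exists_isFlagSeq :
    ∀ {X' X : Scheme.{u}} {π : X' ⟶ X} {K : X.IdealSheafData} {N : ℕ} {K' : X'.IdealSheafData},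
      IsSingPermissibleSeq π K N K' → ∀ (𝔟 R₁ : X.IdealSheafData), K = 𝔟 ⊔ R₁ ^ 2 → N = 2 →
      IsLocallyNoetherian X → Scheme.IsRegular X →
      ∃ 𝔟' R₁' : X'.IdealSheafData, IsFlagSeq π 𝔟 R₁ 𝔟' R₁' ∧ K' = 𝔟' ⊔ R₁' ^ 2 ∧
        IsLocallyNoetherian X' ∧ Scheme.IsRegular X' := by
  intro X' X π K N K' h
  induction h with
  | nil K N =>
    intro 𝔟 R₁ hK _ hXn hXr
    exact ⟨𝔟, R₁, IsFlagSeq.nil 𝔟 R₁, hK, hXn, hXr⟩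
  | @cons X₃ X₂ X₁ τ π₂ K₁ N K₂ Y hπ₂ hYint hYreg hY hτ ih =>
    intro 𝔟 R₁ hK hN hXn hXr
    obtain ⟨𝔟', R₁', hfs, hK', hX₂n, hX₂r⟩ := ih 𝔟 R₁ hK hN hXn hXr
    subst hN
    haveI := hX₂n
    have hord𝔟 : ∀ y ∈ (Y : Set X₂), ((2 : ℕ) : ℕ∞) ≤ idealOrder 𝔟' y := fun y hy =>
      (hY y hy).trans (by rw [hK']; exact idealOrder_anti' le_sup_left y)
    have hordR : ∀ y ∈ (Y : Set X₂), ((1 : ℕ) : ℕ∞) ≤ idealOrder R₁' y := by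
      intro y hy
      haveI : IsRegularLocalRing (X₂.presheaf.stalk y) := hX₂r y
      have h2 : ((2 : ℕ) : ℕ∞) ≤ idealOrder (R₁' ^ 2) y :=
        (hY y hy).trans (by rw [hK']; exact idealOrder_anti' le_sup_right y)
      have h2' : (((2 * 1 : ℕ)) : ℕ∞) ≤ idealOrder (R₁' ^ 2) y := by simpa using h2
      exact (le_idealOrder_pow_iff R₁' (by norm_num) 1).mp h2'
    -- (tree lemma, kernel-checked commutative algebra `J ⊆ 𝓘_Y^μ` for a regular centre in `{ord ≥ μ}`;
    -- NOT a manuscript item used as a premise)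
    have h𝔟C : 𝔟' ≤ vanishingIdeal Y ^ 2 :=
      Literature.AlgebraicGeometry.Hironaka2017.le_vanishingIdeal_pow_of_forall_le_idealOrder hX₂r hYreg hord𝔟
    have hRC1 : R₁' ≤ vanishingIdeal Y ^ 1 :=
      Literature.AlgebraicGeometry.Hironaka2017.le_vanishingIdeal_pow_of_forall_le_idealOrder hX₂r hYreg hordR
    haveI : IsProper τ := hτ.isProper
    haveI hX₃n : IsLocallyNoetherian X₃ := LocallyOfFiniteType.isLocallyNoetherian τ
    have hRC : R₁' ≤ vanishingIdeal Y := by simpa using hRC1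
    refine ⟨controlledTransform τ (vanishingIdeal Y) 𝔟' 2,
      controlledTransform τ (vanishingIdeal Y) 𝔟' 2 ⊔ controlledTransform τ (vanishingIdeal Y) R₁' 1,
      IsFlagSeq.cons τ π₂ 𝔟 R₁ 𝔟' R₁' (vanishingIdeal Y) hfs hYreg h𝔟C hRC hτ, ?_, ?_, ?_⟩
    · -- the transform law `τᶜ(𝔟' ⊔ R₁'², 2) = τᶜ(𝔟',2) ⊔ τᶜ(R₁',1)²`, then `A ⊔ B² = A ⊔ (A ⊔ B)²`
      have hD := hτ.isEffectiveCartier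
      have h1 : 𝔟'.comap τ ≤ (vanishingIdeal Y).comap τ ^ 2 := comap_le_comap_pow_of_le_pow h𝔟C τ
      have hR1 : R₁'.comap τ ≤ (vanishingIdeal Y).comap τ ^ 1 := comap_le_comap_pow_of_le_pow hRC1 τ
      have hR2 : (R₁' ^ 2).comap τ ≤ (vanishingIdeal Y).comap τ ^ 2 :=
        comap_le_comap_pow_of_le_pow (pow_le_pow_left₀ (by simp) hRC 2) τ
      have hpow : controlledTransform τ (vanishingIdeal Y) (R₁' ^ 2) 2 =
          controlledTransform τ (vanishingIdeal Y) R₁' 1 ^ 2 := by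
        simpa using controlledTransform_pow hD hR1 2
      rw [hK', controlledTransform_sup hD h1 hR2, hpow, sup_sq_sup_eq]
    · exact hX₃n
    · exact IsBlowup.isRegular_of_isRegular_subscheme hX₂r hYreg hτ


/-! ## `Cascade₂` ASSEMBLED (res-D-pv-054) -/

/-- **PACKAGING: a child cascade is a Σ-permissible sequence for `(I, N)` with current ideal `D · J`** (on the stages, which
are regular and locally Noetherian): each child step blows up a regular integral centre inside `{ord J = μ}`, `μ ≥ N`, hence
inside `{ord (D·J) ≥ N}`, and `τᶜ(D·J, N) = (D𝒪 · 𝓘_exc^{μ-N}) · τᶜ(J, μ)` (effective-Cartier cancellation).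
[cite: BierstoneGrigorievMilmanWlodarczyk2011, Lemma 3.7.1 (2)] [cite: CossartPiltant2008, Prop. 4.4] -/
theorem IsChildCascade.isSingPermissibleSeq {N : ℕ} {S : Scheme.{u}} [IsLocallyNoetherian S]
    (hS : Scheme.IsRegular S) {I : S.IdealSheafData} :
    ∀ {X : Scheme.{u}} {ρ : X ⟶ S} {D J : X.IdealSheafData}, IsChildCascade N S I ρ D J →
      Scheme.IsRegular X ∧ ∃ _ : IsLocallyNoetherian X, IsSingPermissibleSeq ρ I N (D * J) := by
  intro X ρ D J h
  induction h with
  | start H J hH hHJ hcoh =>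
    refine ⟨hS, inferInstance, ?_⟩
    rw [hHJ]
    exact IsSingPermissibleSeq.nil I N
  | @step X' X ρ D J τ Y μ hc hμ hYint hYreg hY hτ ih =>
    obtain ⟨hXr, hXn, hseq⟩ := ih
    haveI := hXn
    haveI : IsLocallyNoetherian X' := hτ.isLocallyNoetherian
    refine ⟨hτ.isRegular_of_isRegular_subscheme hXr hYreg, inferInstance, ?_⟩
    have hordDJ : ∀ y ∈ (Y : Set X), (N : ℕ∞) ≤ idealOrder (D * J) y := fun y hy => by
      have h := le_idealOrder_mul_of_le D J y (a := 0) (b := μ) (by simp) (by rw [hY y hy])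
      rw [Nat.zero_add] at h
      exact le_trans (by exact_mod_cast hμ) h
    have hstep := IsSingPermissibleSeq.cons τ ρ I N (D * J) Y hseq hYint hYreg hordDJ hτ
    -- the transform law
    have hDJle : D * J ≤ vanishingIdeal Y ^ N :=
      le_pow_of_isRegular_subscheme_of_forall_le_idealOrder_of_isRegular hXr hYreg fun y hy => hordDJ y (by
        rwa [← Scheme.IdealSheafData.coe_support_vanishingIdeal Y])
    have h1 := hτ.comap_eq_pow_mul_controlledTransform_of_le_pow hDJle
    have h2 : (D * J).comap τ = (vanishingIdeal Y).comap τ ^ N *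
        (D.comap τ * (vanishingIdeal Y).comap τ ^ (μ - N) * controlledTransform τ (vanishingIdeal Y) J μ) := by
      rw [comap_mul, ← hτ.pow_mul_controlledTransform_eq_of_forall_idealOrder_eq hXr hYreg hY]
      obtain ⟨k, hk⟩ := Nat.exists_eq_add_of_le hμ
      rw [hk, Nat.add_sub_cancel_left, pow_add]
      ring
    rw [h1] at h2
    have heq := (hτ.isEffectiveCartier.pow N).eq_of_mul_eq_mul h2
    rw [heq] at hstep
    exact hstep

/-- [OURS · L1 W5.2] **TARGET (9b) `Cascade₂` HOLDS modulo [CoP1] Prop. 4.4** (F-33 `CossartPiltant2008_prop44` as an explicit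
CONDITIONAL binder — NOT an admissible premise of the chain): for `𝒥 = 𝔟 ⊔ R₁²` on the regular excellent integral threefold `E`,
the CHILD cascade (`exists_childCascade`, `N = 2`) followed by the single COMPANION phase `μ = 1` (`companionCascade_of_descent`
with `companionDescent_of_prop44`) is a Σ-permissible sequence for `(𝒥, 2)` (`IsChildCascade.isSingPermissibleSeq`,
`IsSingPermissibleSeq.comp`), hence a flag sequence (`IsSingPermissibleSeq.exists_isFlagSeq`) whose end flag ideal is
`D' · J'` with `D'` effective Cartier, `ord J' ≤ 1`, and `ord_x J' ≥ 1 ⇒ ord_x D' = 0` (= `INV(0)`) — `CascadeEnd₂`; the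
bookkeeping clauses by the tree's `IsFlagSeq.flagState₃`. [cite: CossartPiltant2008, Prop. 4.4]
[cite: BierstoneGrigorievMilmanWlodarczyk2011, Lemma 3.7.1] [cite: Kollar2007, 3.111 Step 3] -/
theorem cascade₂_of_prop44 (h44 : CossartPiltant2008_prop44.{u}) : Cascade₂.{u} := by
  intro E _ _ hreg hexc hdim 𝔟 R₁ h𝔟 hlp hle
  set I : E.IdealSheafData := 𝔟 ⊔ R₁ ^ 2 with hIdef
  have hI : I ≠ ⊥ := fun h => h𝔟 (eq_bot_iff.mpr (le_sup_left.trans h.le))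
  -- the child cascade at `N = 2`
  obtain ⟨X, hXi, hXn, ρ, H, D, J, hc, hρ, hH, hD, hfac, hcoh, hlt⟩ :=
    exists_childCascade (N := 2) (by norm_num) E hreg hexc I hI (prop44From_of_prop44 h44 (by norm_num) E hreg hexc hdim I hI)
  haveI := hXi
  haveI := hXn
  obtain ⟨-, _, hseq1⟩ := hc.isSingPermissibleSeq hreg
  -- the single companion phase `μ = 1`
  have hst : StageData E I X ρ H D J := ⟨hρ, hH, hD, hfac, hcoh⟩
  have hinv : NoStratumAbove D J 2 1 := ⟨hlt, fun x μ' h1 h2 _ => by omega⟩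
  obtain ⟨X', hXi', hXn', π, M', D', J', hseq2, hst', hinv0⟩ :=
    companionCascade_of_descent (companionDescent_of_prop44 h44) E hreg hexc hdim I hI (N := 2) (by norm_num) 1 X ρ H D J
      hst (by norm_num) hinv
  haveI := hXi'
  haveI := hXn'
  have hseq : IsSingPermissibleSeq (π ≫ ρ) I 2 (D' * J') := hseq2.comp hseq1
  -- the flag reading
  obtain ⟨𝔟', R₁', hfs, hK', -, -⟩ := hseq.exists_isFlagSeq 𝔟 R₁ rfl rfl inferInstance hreg
  refine ⟨X', π ≫ ρ, 𝔟', R₁', hfs, hfs.flagState₃ ⟨inferInstance, inferInstance, hreg, hexc, hdim, h𝔟, hlp, hle⟩,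
    D', J', hK'.symm, hst'.2.2.1, fun x => ?_, fun x hx => ?_⟩
  · exact Order.le_of_lt_add_one (by simpa only [show (1 : ℕ∞) + 1 = ((2 : ℕ) : ℕ∞) from rfl] using hinv0.1 x)
  · have h := hinv0.2 x 1 zero_lt_one one_lt_two (by exact_mod_cast hx)
    have h' : idealOrder D' x < 1 := by simpa using h
    exact Order.lt_one_iff.mp h'

end DepthCascade

namespace DepthTargets

/-- [OURS · L1 W5.2] **TARGET (9b) `Cascade₂` BY NAME, modulo [CoP1] Prop. 4.4** (see `DepthCascade.cascade₂_of_prop44`).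
[cite: CossartPiltant2008, Prop. 4.4] -/
theorem cascade₂_of_prop44 (h44 : CossartPiltant2008_prop44.{u}) : Cascade₂.{u} :=
  DepthCascade.cascade₂_of_prop44 h44

end DepthTargets

end Summit.ResolutionOfSingularities.ResolutionOfSingularities.Theorems

end
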